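import Literature.Topology.FourManifolds.SliceDiscEndCollar

/-!
# Manolescu–Piccirillo Lemma 3.3 for `W = S⁴`: the reduction after the two end collars

Topic `Literature/Topology/FourManifolds`; fact seat of
`Literature.Topology.FourManifolds.Knot.ManolescuPiccirillo2023_lemma33_sphere` (Manolescu–Piccirillo,
*From zero surgeries to candidates for exotic definite 4-manifolds* (2023), Lemma 3.3 for `W = S⁴`: knots
with a common `0`-surgery, one smoothly slice ⇒ the other bounds a disc in a homotopy `4`-ball).

State of the decomposition (all files of this topic):

* construction leaf (T), the collared end of the open trace — **proved**
  (`Knot.exists_openTrace_of_isIntegralSurgery_holds`, `OpenTraceCollar.lean`);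
* construction leaf (V), the collared end of the slice-disc exterior — **reduced** to the two classical
  normal-form facts of `SliceDiscEndCollarFacts.lean`
  (`Knot.IsSliceDisc.exists_endCollar_of_isIntegralSurgery_zero_of_facts`, `SliceDiscEndCollar.lean`);
* the gluing of the two pieces along `Y × ℝ` and the assembly — **proved**
  (`ManolescuPiccirillo2023_lemma33_sphere_construction_of_collars`,
  `ManolescuPiccirillo2023_lemma33_sphere_of_collars`, `ZeroSurgeryHomotopyBallSliceConstruction.lean`).

Hence the printed Lemma 3.3 for `W = S⁴` now rests on exactly five named facts: the two normal-form facts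
for slice discs (`Knot.IsSliceDisc.exists_conical_diffeomorph`,
`Knot.IsSliceDisc.exists_conicalTube_hasFraming_zero`: Kosinski (1993), II (2.8.2), III (4.2); Kirby
(1989), Ch. I §2), the two computations `π₁ = 1`, `H₂ = 0` of the glued manifold
(`Knot.simplyConnectedSpace_of_isSliceDiscIn_of_range_eq`,
`Knot.isZero_singularHomologyZ_two_of_isSliceDiscIn_of_range_eq`, `ZeroSurgeryHomotopyBallSliceProofs.lean`)
and the recognition of homotopy `4`-spheres
(`Literature.Topology.FourManifolds.nonempty_homotopyEquiv_sphere_four_iff`). This file records that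
reduction as one theorem. No `sorry`, no definitions.

## References

* C. Manolescu, L. Piccirillo, J. London Math. Soc. (2023), §3.2, Lemma 3.3 and Definition 3.4.
  [cite: ManolescuPiccirillo2023, §3.2, Lemma 3.3]
-/

noncomputable section

namespace Literature.Topology.FourManifolds

namespace Knot

/-- **Manolescu–Piccirillo, Lemma 3.3 for `W = S⁴`, from five named facts**: the conical normal form of
slice discs and their framed conical tubes (`SliceDiscEndCollarFacts.lean`), the two homotopy/homology
computations of the glued manifold, and the recognition of homotopy `4`-spheres. The two end collars
(open trace: proved; slice-disc exterior: from the first two facts) feed the proved gluing and assembly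
of `ZeroSurgeryHomotopyBallSliceConstruction.lean`. [cite: ManolescuPiccirillo2023, §3.2, Lemma 3.3] -/
theorem ManolescuPiccirillo2023_lemma33_sphere_of_sliceDisc_facts
    (h₁ : IsSliceDisc.exists_conical_diffeomorph)
    (h₂ : IsSliceDisc.exists_conicalTube_hasFraming_zero)
    (hπ : simplyConnectedSpace_of_isSliceDiscIn_of_range_eq.{0})
    (hH : isZero_singularHomologyZ_two_of_isSliceDiscIn_of_range_eq.{0})
    (hS10 : FourManifolds.nonempty_homotopyEquiv_sphere_four_iff.{0}) :
    ManolescuPiccirillo2023_lemma33_sphere :=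
  ManolescuPiccirillo2023_lemma33_sphere_of_collars exists_openTrace_of_isIntegralSurgery_holds
    (IsSliceDisc.exists_endCollar_of_isIntegralSurgery_zero_of_facts h₁ h₂) hπ hH hS10

end Knot

end Literature.Topology.FourManifolds
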